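import Literature.NumberTheory.EllipticCurves.KubertTateThirteen
import Literature.NumberTheory.EllipticCurves.KubertTateNormalForm

/-!
# k1 gen 12 — B5 transcription sanity (Plan B / KF13), kernel-checked over `𝔽₁₀₁`

B5 (`j_mul_hauptmodulThirteen`, companion `STUB_IDEAS_stub_pasten163_1g6.lean:267`) cleared of
denominators: with `W = E(rs(r-1), s(r-1))`, `N = hauptThirteenNum r s`, `D = hauptThirteenDen r s`
(copied VERBATIM from the companion, ll. 226–233),
`B5poly r s := c₄(W)³·N·D¹³ − Δ(W)·(N²+5ND+13D²)(N⁴+7N³D+20N²D²+19ND³+D⁴)³`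
must vanish on `kubertTateRaw₁₃ r s = 0`.  Checked here BY THE KERNEL at three `𝔽₁₀₁`-points of the
raw `X₁(13)` against the TREE's own `kubertTate`, `kubertTateRaw₁₃`, `c₄`, `Δ`
(any transcription slip in `τ` would make B5 false and burn a prover cycle), plus an off-curve control.
Exhaustive version (Python, this session, same formulas): all 29 + 96 + 219 points of `F₁₃ = 0` over
`𝔽₃₁, 𝔽₁₀₁, 𝔽₂₁₁` satisfy it (0 failures).
-/

namespace Summit.ABC.ABC.Cruxes.DefiniteRTControlPrime.Sketch.Ideas1g12

open WeierstrassCurve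

set_option linter.dupNamespace false

/-- Numerator of `τ` (verbatim copy of the companion's `hauptThirteenNum`). -/
noncomputable def hauptThirteenNum' {R : Type*} [CommRing R] (r s : R) : R :=
  (s - 1) * ((r - 1) ^ 2 * s ^ 3 + (-8 * r ^ 2 + 5 * r + 3) * s ^ 2 + (16 * r ^ 2 - 20 * r + 3) * s + 1)

/-- Denominator of `τ` (verbatim copy of the companion's `hauptThirteenDen`). -/
noncomputable def hauptThirteenDen' {R : Type*} [CommRing R] (r s : R) : R :=
  r * s ^ 4 + (r ^ 2 - 3 * r) * s ^ 3 + (-5 * r ^ 2 + 6 * r) * s ^ 2 + (6 * r ^ 2 - 7 * r + 1) * s +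
    (-r ^ 2 + r)

/-- B5 with denominators cleared (a polynomial in `r, s`). -/
noncomputable def B5poly {R : Type*} [CommRing R] (r s : R) : R :=
  (kubertTate (r * s * (r - 1)) (s * (r - 1))).c₄ ^ 3 * hauptThirteenNum' r s *
      hauptThirteenDen' r s ^ 13 -
    (kubertTate (r * s * (r - 1)) (s * (r - 1))).Δ *
      ((hauptThirteenNum' r s ^ 2 + 5 * hauptThirteenNum' r s * hauptThirteenDen' r s +
          13 * hauptThirteenDen' r s ^ 2) *
        (hauptThirteenNum' r s ^ 4 + 7 * hauptThirteenNum' r s ^ 3 * hauptThirteenDen' r s +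
            20 * hauptThirteenNum' r s ^ 2 * hauptThirteenDen' r s ^ 2 +
            19 * hauptThirteenNum' r s * hauptThirteenDen' r s ^ 3 + hauptThirteenDen' r s ^ 4) ^ 3)

example : kubertTateRaw₁₃ (2 : ZMod 101) 29 = 0 ∧ B5poly (2 : ZMod 101) 29 = 0 := by
  decide +kernel

example : kubertTateRaw₁₃ (5 : ZMod 101) 79 = 0 ∧ B5poly (5 : ZMod 101) 79 = 0 := by
  decide +kernel

example : kubertTateRaw₁₃ (6 : ZMod 101) 15 = 0 ∧ B5poly (6 : ZMod 101) 15 = 0 := by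
  decide +kernel

/-- Control: off the curve the polynomial does NOT vanish (so the check is not vacuous). -/
example : kubertTateRaw₁₃ (2 : ZMod 101) 3 ≠ 0 ∧ B5poly (2 : ZMod 101) 3 ≠ 0 := by
  decide +kernel

end Summit.ABC.ABC.Cruxes.DefiniteRTControlPrime.Sketch.Ideas1g12
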